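import Mathlib

/-!
Sketch for crux idea `bfj-band-pricing` (val-idea-20 g3; rev 2 by g4 adds `BandLaw34OfBFJBand`, `UnitDegreeBound`) on `LacunarySymmetroid.MatrixDescartes` (stmt-18050),
territory of `Lift.stub_twoSided`.  Three typed statements (no proofs):
* `InertiaPricedCount` — the counting engine (pure linear algebra; certainly true: Weyl subadditivity of the
  positive index + Schur product theorem + rank of a Hadamard product);
* `BFJBand` — the cited input: Bhatia–Friedland–Jain, *Inertia of Loewner matrices*, Indiana Univ. Math. J. 65
  (2016) 1251–1261 = arXiv:1501.01505, Theorem 1.1 (ii)(iii): for `2k − 1 ≤ ρ ≤ 2k` the Loewner matrix of `s ↦ s^ρ`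
  at any distinct positive points has exactly / at most `k` positive eigenvalues (stated as: NSD on a subspace of
  codimension ≤ k), and the mirror statement for `−(2k+1) ≤ ρ ≤ −2k` (and `−1 ≤ ρ < 0`: NSD, k = 0);
* `BandLaw34` — the first new sector law the two give: the word `{−a ∣ b, c}` with `a ≤ b`, `3b ≤ c ≤ 4b`.
-/

namespace Summit.ValiantsHypothesis.ValiantsHypothesis.Cruxes.MatrixDescartes.BFJBandPricing

open Matrix Polynomial Finset
open scoped BigOperators Matrix

/-- `π(A) ≤ p`, phrased without eigenvalues: `A` is negative semidefinite on a subspace of codimension ≤ `p`. -/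
def PosIndexLE {Z : ℕ} (A : Matrix (Fin Z) (Fin Z) ℝ) (p : ℕ) : Prop :=
  ∃ W : Submodule ℝ (Fin Z → ℝ), Z ≤ Module.finrank ℝ W + p ∧ ∀ w ∈ W, w ⬝ᵥ A.mulVec w ≤ 0

/-- ENGINE.  If `diag x = Σ_c K_c ⊙ G_c` with `G_c ⪰ 0` of rank ≤ `r_c` and `π(K_c) ≤ p_c`, then the number of
positive diagonal entries is at most `Σ_c p_c · r_c`.  (At the positive zeros `t_a` of a Lift-form pencil, with
kernel vectors `v_a`: `G_c = [v_aᵀ S_c v_b]`, `K_c` = Loewner matrix of `s ↦ s^{(d_c − e)/θ}` at `s_a = t_a^θ`,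
`x_a ∝ v_aᵀ N′(t_a) v_a` = crossing slope; so LHS = number of ascending crossings.) -/
def InertiaPricedCount : Prop :=
  ∀ (Z : ℕ) (κ : Type) [Fintype κ] (K G : κ → Matrix (Fin Z) (Fin Z) ℝ) (p r : κ → ℕ) (x : Fin Z → ℝ),
    (∀ c, (G c).PosSemidef) → (∀ c, (G c).rank ≤ r c) → (∀ c, (K c).IsSymm) → (∀ c, PosIndexLE (K c) (p c)) →
    Matrix.diagonal x = ∑ c, (K c ⊙ G c) →
    (univ.filter (fun a => 0 < x a)).card ≤ ∑ c, p c * r c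

/-- Loewner matrix of the power function `s ↦ s^ρ` at the points `s` (diagonal = derivative). -/
noncomputable def loewnerPow {Z : ℕ} (s : Fin Z → ℝ) (ρ : ℝ) : Matrix (Fin Z) (Fin Z) ℝ :=
  Matrix.of fun i j => if i = j then ρ * (s i) ^ (ρ - 1) else ((s i) ^ ρ - (s j) ^ ρ) / (s i - s j)

/-- CITED INPUT (Bhatia–Friedland–Jain 2016, Thm 1.1 (ii)(iii) + the remark `In(L_{−r}) = In(L_r)` reversed):
on the band `2k − 1 ≤ ρ ≤ 2k` (`k ≥ 1`) the Loewner matrix of `s^ρ` has positive index ≤ `k`; on the band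
`−(2k+1) ≤ ρ ≤ −2k` (`k ≥ 0`, the case `k = 0` read as `−1 ≤ ρ < 0`) likewise ≤ `k`.  Unproved in the tree. -/
def BFJBand : Prop :=
  ∀ (Z k : ℕ) (s : Fin Z → ℝ) (ρ : ℝ), StrictMono s → (∀ i, 0 < s i) →
    ((1 ≤ k ∧ (2 * k - 1 : ℝ) ≤ ρ ∧ ρ ≤ 2 * k) ∨ (-(2 * k + 1 : ℝ) ≤ ρ ∧ ρ ≤ -(2 * k : ℝ) ∧ ρ < 0)) →
    PosIndexLE (loewnerPow s ρ) k

/-- Positive distinct roots of `det` of a four-letter word `X^a J + P + X^{a+b} Q + X^{a+c} R`. -/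
noncomputable def posRoots₃ {n : ℕ} (a b c : ℕ) (J P Q R : Matrix (Fin n) (Fin n) ℝ) : Finset ℝ :=
  ((Matrix.det ((X : ℝ[X]) ^ a • J.map C + P.map C + (X : ℝ[X]) ^ (a + b) • Q.map C
      + (X : ℝ[X]) ^ (a + c) • R.map C)).roots.toFinset).filter (fun t => 0 < t)

/-- FIRST NEW SECTOR LAW predicted by ENGINE + BFJ (band `[3,4]` above the pivot, band `(0,1]` below):
for `0 < a ≤ b`, `3b ≤ c ≤ 4b`, `J` symmetric, `P, Q, R ⪰ 0`, `det ≢ 0`: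
`Z₊ ≤ 2·(rank Q + 2·rank R) + n` (ascending crossings ≤ rank Q + 2 rank R; descending ≤ ascending + n by branch
alternation).  Degree-free (a, b, c arbitrary large), K-dependent through the ranks, linear in n; outside every
landed window (`c > 2b`).  Tangential zeros: the prover adds the usual `±ε I` perturbation or a simplicity hypothesis. -/
def BandLaw34 : Prop :=
  ∀ (n a b c : ℕ) (J P Q R : Matrix (Fin n) (Fin n) ℝ), 0 < a → a ≤ b → 3 * b ≤ c → c ≤ 4 * b →
    J.IsSymm → P.PosSemidef → Q.PosSemidef → R.PosSemidef →
    Matrix.det ((X : ℝ[X]) ^ a • J.map C + P.map C + (X : ℝ[X]) ^ (a + b) • Q.map C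
      + (X : ℝ[X]) ^ (a + c) • R.map C) ≠ 0 →
    (posRoots₃ a b c J P Q R).card ≤ 2 * (Q.rank + 2 * R.rank) + n


/-! ### rev 2 (val-idea-20 g4): the prover target (critic price P2) and the comparison law (P3′) -/

/-- P2 TARGET (critic val-idea-crit-6 VERDICT #19): the deliverable for a prover seat is this implication with the
ENGINE `InertiaPricedCount` proved outright inside the proof (no engine hypothesis); `BFJBand` stays a cited
hypothesis (arXiv:1501.01505 Thm 1.1 (ii)(iii)(iv) + reversal remark p.3). -/
def BandLaw34OfBFJBand : Prop := BFJBand → BandLaw34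

/-- Positive distinct roots of `det (∑ₗ X^{kₗ} Sₗ)` (general real letters). -/
noncomputable def posRootsOf {n K : ℕ} (k : Fin K → ℕ) (S : Fin K → Matrix (Fin n) (Fin n) ℝ) : Finset ℝ :=
  ((Matrix.det (∑ l, (X : ℝ[X]) ^ k l • (S l).map C)).roots.toFinset).filter (fun t => 0 < t)

/-- P3′ COMPARISON LAW (elementary, true for arbitrary real letters: multilinearity of `det` over rank-one pieces
gives `natDegree (det ∑ₗ X^{kₗ} Sₗ) ≤ ∑ₗ kₗ · rank Sₗ`).  The RANK-SENSITIVE DEGREE BOUND IN THE UNIT `t^θ`: when every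
offset of a word is a multiple of `θ` (`δ_c = θ·k_c`), the priced bound `2·∑_c p(δ_c/θ)·rank S_c + n` of this card is
`≈ ∑_c k_c·rank S_c + n`, i.e. never better than this law — the card has content only on NON-commensurable split words
whose ratios lie in closed BFJ bands. -/
def UnitDegreeBound : Prop :=
  ∀ (n K : ℕ) (k : Fin K → ℕ) (S : Fin K → Matrix (Fin n) (Fin n) ℝ),
    Matrix.det (∑ l, (X : ℝ[X]) ^ k l • (S l).map C) ≠ 0 →
    (posRootsOf k S).card ≤ ∑ l, k l * (S l).rank

end Summit.ValiantsHypothesis.ValiantsHypothesis.Cruxes.MatrixDescartes.BFJBandPricing
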